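import Mathlib
import HarnessLib
import Literature.Analysis.FluidPDE.SelfSimilar
import Literature.Analysis.FluidPDE.NSBoundedMildAnalytic

/-!
# Route UnthreadedRigidityDoor · crux `UnthreadedRigidity` (stmt-NavierStokesRegularity-27585) · LINE «jet rigidity»
# (planner ns-idea-6 g5, birth skeleton sha16 `5d320f85a8de9ffc`) — stub `stub_windowAnalytic`, file 1/2:
# JOINT REAL-ANALYTICITY of a bounded continuous Oseen-mild field on an OPEN TIME WINDOW

Seat ns-qj-p1 g3 (director-ns KEY-NS #141), `--supports stmt-NavierStokesRegularity-27585 --as helper`.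
The registered stub `StubWindowAnalytic` asks: a continuous, divergence-free, Oseen-mild field `u` on an open
time window `S` (`u(t) = e^{(t−s)Δ}u(s) − B¹_s(u,u)(t)` for `s < t` in `S`), bounded on every initial segment
of `S`, is jointly REAL-ANALYTIC on `S × ℝ³` and a classical solution of the vorticity formulation. This file
proves the analyticity (the vorticity formulation is in the sequel `UnthreadedRigidityDoorWindowAnalytic`):

* `analyticOnNhd_uncurry_of_oseenMild_of_isOpen` — for `S` open, `u` continuous on `S × ℝ³`, Oseen-mild between
  any two times `s < t` of `S`, and bounded on `{t ∈ S, t ≤ τ}` for every `τ ∈ S`: `uncurry u` is real-analytic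
  on `S × ℝ³`. (No divergence-free hypothesis and no connectedness of `S` are used.)

PROOF (window-local form of the tree's `analyticOnNhd_uncurry_of_oseenMild`, Lemarié-Rieusset 2016 Thm. 9.12):
near `t₁ ∈ S` choose `ρ > 0` with `[t₁ − ρ, t₁ + ρ] ⊆ S`, a bound `M` of `u` on `{t ∈ S, t ≤ t₁ + ρ}`, and
restart at `s = t₁ − δ` with `δ ≤ min(ρ, h/2)`, `h = ε/M²` the lifespan of the proved local fact
`lemarieRieusset2016_local_analyticity_holds`: the local analytic solution `v` of Oseen's scheme from the bounded
datum `u(s)` lives on `(s, s + h) ∋ t₁` and coincides with `u` on `(s, T₂)`, `T₂ = min(s + h, t₁ + ρ)`, by the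
uniqueness of bounded solutions of the Oseen integral equation (`oseenMild_bounded_unique`) and continuity of
both fields; hence `u` is analytic at `(t₁, x)`.

HONEST FRAMING: a regularity statement about HYPOTHETICAL bounded window solutions (local blow-up profiles of the
door); nothing here bears on `UnthreadedRigidity`, the door Target, or Navier–Stokes regularity; no summit
statement is proved. [folklore]

References: P. G. Lemarié-Rieusset, *The Navier–Stokes Problem in the 21st Century* (CRC 2016), Thm. 9.12;
G. Koch, N. Nadirashvili, G. Seregin, V. Šverák, Acta Math. 203 (2009) §4.
-/

noncomputable section

-- the summit and its single sub-problem share the name (CONVENTIONS §1), as in every Theorems file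
set_option linter.dupNamespace false

namespace Summit.NavierStokesRegularity.NavierStokesRegularity.Theorems.UnthreadedRigidity

open Literature.Analysis.FluidPDE MeasureTheory Set Function Filter Topology
open Literature.Analysis.UnboundedOperators (heatExtension)
open scoped ENNReal NNReal

variable {S : Set ℝ} {u : ℝ → (EuclideanSpace ℝ (Fin 3)) → (EuclideanSpace ℝ (Fin 3))}

/-- Slices of a field continuous on `S × ℝ³` are continuous (`t ∈ S`). [folklore] -/
theorem continuous_slice_of_continuousOn (hcont : ContinuousOn (uncurry u) (S ×ˢ univ)) {t : ℝ}
    (ht : t ∈ S) : Continuous (u t) :=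
  hcont.comp_continuous (f := fun y => (t, y)) (by fun_prop) fun y => mk_mem_prod ht (mem_univ _)

/-- **Joint real-analyticity of a bounded continuous Oseen-mild field on an open time window** (Lemarié-Rieusset
2016, Thm. 9.12, via the tree's proved local fact `lemarieRieusset2016_local_analyticity_holds` and the
uniqueness of bounded Oseen-mild solutions `oseenMild_bounded_unique`): for `S` open, `u` continuous on
`S × ℝ³`, `u(t) = e^{(t−s)Δ}u(s) − B¹_s(u,u)(t)` for all `s < t` in `S`, and `u` bounded on `{t ∈ S, t ≤ τ}` for
every `τ ∈ S`, the field is real-analytic on `S × ℝ³`.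
[cite: LemarieRieusset2016, Thm. 9.12 (PDF p. 260; proof pp. 260–263)] -/
theorem analyticOnNhd_uncurry_of_oseenMild_of_isOpen (hS : IsOpen S)
    (hcont : ContinuousOn (uncurry u) (S ×ˢ univ))
    (hmild : ∀ s ∈ S, ∀ t ∈ S, s < t → ∀ x,
      u t x = heatExtension (u s) (t - s) x - oseenDuhamel 1 s u u t x)
    (hbdd : ∀ τ ∈ S, ∃ B : ℝ, ∀ t ∈ S, t ≤ τ → ∀ x, ‖u t x‖ ≤ B) :
    AnalyticOnNhd ℝ (uncurry u) (S ×ˢ (univ : Set (EuclideanSpace ℝ (Fin 3)))) := by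
  obtain ⟨ε, hε, CL, -, hLoc⟩ := lemarieRieusset2016_local_analyticity_holds
  intro z hz
  obtain ⟨hz1, -⟩ := mem_prod.1 hz
  -- a symmetric interval `[t₁ - ρ, t₁ + ρ] ⊆ S`
  obtain ⟨ρ₀, hρ₀, hball⟩ := Metric.isOpen_iff.1 hS z.1 hz1
  set ρ : ℝ := ρ₀ / 2 with hρ
  have hρ0 : 0 < ρ := by positivity
  have hmemS : ∀ t : ℝ, z.1 - ρ ≤ t → t ≤ z.1 + ρ → t ∈ S := fun t h1 h2 =>
    hball (by rw [Metric.mem_ball, Real.dist_eq, abs_lt]; constructor <;> linarith)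
  -- a bound `M > 0` on `{t ∈ S, t ≤ t₁ + ρ}`
  obtain ⟨B, hB⟩ := hbdd (z.1 + ρ) (hmemS _ (by linarith) le_rfl)
  set M : ℝ := max B 0 + 1 with hM
  have hM0 : 0 < M := by
    have : 0 ≤ max B 0 := le_max_right _ _
    linarith
  have hbdM : ∀ t ∈ S, t ≤ z.1 + ρ → ∀ y, ‖u t y‖ ≤ M := fun t ht hle y =>
    ((hB t ht hle y).trans (le_max_left _ _)).trans (by linarith)
  -- the window
  set h : ℝ := ε * 1 / M ^ 2 with hh
  have hh0 : 0 < h := by positivity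
  set δ : ℝ := min (h / 2) ρ with hδ
  have hδ0 : 0 < δ := lt_min (by linarith) hρ0
  have hδh : δ ≤ h / 2 := min_le_left _ _
  have hδρ : δ ≤ ρ := min_le_right _ _
  set s : ℝ := z.1 - δ with hs
  set T₂ : ℝ := min (s + h) (z.1 + ρ) with hT₂
  have hst₁ : s < z.1 := by linarith
  have ht₁T₂ : z.1 < T₂ := lt_min (by linarith) (by linarith)
  have hT₂h : T₂ ≤ s + h := min_le_left _ _
  have hT₂ρ : T₂ ≤ z.1 + ρ := min_le_right _ _
  have hsS : s ∈ S := hmemS s (by linarith) (by linarith)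
  have hIooS : ∀ t ∈ Ioo s T₂, t ∈ S := fun t ht =>
    hmemS t (by linarith [ht.1]) (by linarith [ht.2])
  -- the datum `u s`
  have ha : AEStronglyMeasurable (u s) volume := (continuous_slice_of_continuousOn hcont hsS).aestronglyMeasurable
  have haM : eLpNorm (u s) ∞ volume ≤ ENNReal.ofReal M := by
    rw [eLpNorm_exponent_top]
    exact eLpNormEssSup_le_of_ae_bound (Eventually.of_forall fun y => hbdM s hsS (by linarith) y)
  obtain ⟨v, hvan, hveq, hvbd⟩ := hLoc one_pos s hM0 ha haM
  -- uniqueness of bounded solutions on `(s, T₂)`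
  have hmax0 : 0 ≤ max M (CL * M) := hM0.le.trans (le_max_left _ _)
  have hum : AEStronglyMeasurable (uncurry u)
      ((volume : Measure (ℝ × (EuclideanSpace ℝ (Fin 3)))).restrict (Ioo s T₂ ×ˢ univ)) :=
    (hcont.mono (prod_mono (fun τ hτ => hIooS τ hτ) Subset.rfl)).aestronglyMeasurable
      (measurableSet_Ioo.prod MeasurableSet.univ)
  have hvm : AEStronglyMeasurable (uncurry v)
      ((volume : Measure (ℝ × (EuclideanSpace ℝ (Fin 3)))).restrict (Ioo s T₂ ×ˢ univ)) :=
    (hvan.continuousOn.mono (prod_mono (Ioo_subset_Ioo_right hT₂h) Subset.rfl)).aestronglyMeasurable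
      (measurableSet_Ioo.prod MeasurableSet.univ)
  have huniq : ∀ t ∈ Ioo s T₂, u t =ᵐ[volume] v t :=
    oseenMild_bounded_unique (ν := 1) (s := s) (T := T₂) (M := max M (CL * M)) (u := u) (v := v)
      (U := fun t x => heatExtension (u s) (t - s) x) one_pos hmax0 hum hvm
      (fun τ hτ y => (hbdM τ (hIooS τ hτ) (hτ.2.le.trans hT₂ρ) y).trans (le_max_left _ _))
      (fun τ hτ y => (hvbd τ ⟨hτ.1, hτ.2.trans_le hT₂h⟩ y).trans (le_max_right _ _))
      (fun t ht => Eventually.of_forall (hmild s hsS t (hIooS t ht) ht.1))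
      (fun t ht => Eventually.of_forall fun x => by
        have h1 := hveq t ⟨ht.1, ht.2.trans_le hT₂h⟩ x
        rwa [one_mul] at h1)
  have hueq : ∀ t ∈ Ioo s T₂, u t = v t := by
    intro t ht
    have hcu : Continuous (u t) := continuous_slice_of_continuousOn hcont (hIooS t ht)
    have hcv : Continuous (v t) :=
      hvan.continuousOn.comp_continuous (f := fun y => (t, y)) (by fun_prop)
        fun y => mk_mem_prod ⟨ht.1, ht.2.trans_le hT₂h⟩ (mem_univ _)
    exact (Continuous.ae_eq_iff_eq volume hcu hcv).1 (huniq t ht)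
  -- analyticity at `z`
  have hzw : z ∈ Ioo s T₂ ×ˢ (univ : Set (EuclideanSpace ℝ (Fin 3))) :=
    mem_prod.2 ⟨⟨hst₁, ht₁T₂⟩, mem_univ _⟩
  have hzv : z ∈ Ioo s (s + ε * 1 / M ^ 2) ×ˢ (univ : Set (EuclideanSpace ℝ (Fin 3))) :=
    mem_prod.2 ⟨⟨hst₁, ht₁T₂.trans_le hT₂h⟩, mem_univ _⟩
  refine (hvan z hzv).congr ?_
  filter_upwards [(isOpen_Ioo.prod isOpen_univ).mem_nhds hzw] with y hy
  obtain ⟨hy1, -⟩ := mem_prod.1 hy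
  change v y.1 y.2 = u y.1 y.2
  rw [hueq y.1 hy1]

/-- Hence such a field is jointly `C^∞` on `S × ℝ³` (`IsSmoothSpaceTimeOn S u`). [folklore] -/
theorem isSmoothSpaceTimeOn_of_oseenMild_of_isOpen (hS : IsOpen S)
    (hcont : ContinuousOn (uncurry u) (S ×ˢ univ))
    (hmild : ∀ s ∈ S, ∀ t ∈ S, s < t → ∀ x,
      u t x = heatExtension (u s) (t - s) x - oseenDuhamel 1 s u u t x)
    (hbdd : ∀ τ ∈ S, ∃ B : ℝ, ∀ t ∈ S, t ≤ τ → ∀ x, ‖u t x‖ ≤ B) :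
    IsSmoothSpaceTimeOn S u :=
  (analyticOnNhd_uncurry_of_oseenMild_of_isOpen hS hcont hmild hbdd).contDiffOn_of_completeSpace

end Summit.NavierStokesRegularity.NavierStokesRegularity.Theorems.UnthreadedRigidity

end
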